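import Summits.HodgeConjecture.HodgeConjecture.Theorems.F0P2mE3FlatInfOfRung3          -- ★ p823249 F0P2-p01 (g6): `e3flat_of_cSharp` (E3♭ ⟸ (C♯)hol + conj; ⊇ ★ F-ISO ∕ RIG-μ ∕ RIG-ε ∕ HR-a)
import Summits.HodgeConjecture.HodgeConjecture.Theorems.F0P2cSocketC                   -- ★ p01 (g3): ⊇ ★ `P2StubU2OfLettersCadmD` p798914, ★ `F0P2dSocketD` p799091, ★ `F0P2fE3OfRung2`, ★ U1′ ∕ `SpectrumInterfacesKernel`
import Summits.HodgeConjecture.HodgeConjecture.Theorems.F0P2cStubCI                    -- ★ p800717: `rhoAtLine_chi_isIrreducible` ∕ `_isAdmissible`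
import Summits.HodgeConjecture.HodgeConjecture.Theorems.F0P3FinPartIsotypic              -- ★ P3 brick I♭ (F0P3-p03 (g5))
import Summits.HodgeConjecture.HodgeConjecture.Theorems.F0P3FinRepConstituentsExist      -- ★ `exists_intertwiningMap_smoothPart_of_hasFinComponent`
import Summits.HodgeConjecture.HodgeConjecture.Theorems.HCCMUnconditionalH413OfF0        -- ★ `H413_of_F0HdictE_F0HJ3a`; imports the route file (`F0HdictE`)
import Literature.RepresentationTheory.Liu2021.GlobalOscillatorIsomorphismCriterion      -- ✔ `nonempty_linearEquiv_of_isotypicComponent_eq_top_of_isIsotypicOfType`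
import Literature.RepresentationTheory.Semisimple.Multiplicity                         -- ★ `Representation.nontrivial_of_isIrreducible`
import HarnessLib

/-!
# Crux `H413` · programme P2 — THE (C♭) SOCKET AND THE ROUTE ITEM 27455 `F0HdictE` FROM THE TWO (C♯) STATEMENTS ALONE, Lines-free
# `cohFinComponentIsThetaAdm_of_cSharp`, `hdictE_of_cSharp` — (C) RETIRED BY DERIVATION (F0P2-plan (g7) 12:04:49Z (a) ∕ N121-1)

Cell hodgecm-mathlib (D-0151), FLOOR 0, crux item H413 = stmt-HodgeConjecture-24833; route support item `F0HdictE` = stmt-HodgeConjecture-27455.  Author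
F0P2-p01 (g6).  THEOREMS ONLY (no `def`, no instance, no notation, no named fact, no `sorry`); kernel lane `--supports stmt-HodgeConjecture-24833 --as helper`;
never imports a `Cruxes/…/Lines` module (O50-1) — the texts (C♯)hol (`F0P2E3Rung3.StubCSharpHol` :206), (C♯)antihol (`StubCSharpAntihol` :241) and (C♭)
(`F0P2CohFinComponentIsThetaC.CohFinComponentIsThetaAdm` :120 = the hypothesis of ★ p798914 `P2StubU2OfLettersCadmD.stub_U2_cohFormsSpectrumIsThetaAt_of_Cadm_D`
= the conclusion of ★ `F0P2cSocketC.cohFinComponentIsThetaAdm_of_CE`) are PASTED VERBATIM.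
HONEST LABEL: HC_CM is proved only modulo the printed citations until rung 0 closes; this file introduces NO letter and discharges none — it DERIVES the old
socket (C♭) (and with it the route item 27455) from the signed letter (C♯)hol + the in-house conj, using only ★ theorems; which road the books count
((C♯)hol signed, or the rung-4 packet chain {S2♯, GR91N, D7α} + E3♭) is the director's (α)∕(β)∕(γ) decision.

THE OBSERVATION (desk 12:04:49Z (a), ref1 N121-1): for an irreducible ADMISSIBLE smooth `σ` occurring in a cotangent discrete automorphic `P` of `U(H)`,
(C♯) realises `P_f` as an irreducible admissible theta carrier `ω′ = ω_H(μ′, a′, χ′)` with `μ′` conjugate-symplectic of weight one; the smooth part of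
`P|_{U(H)(𝔸_f)}` is `σ`-isotypic AND `ω′`-isotypic and non-zero (★ P3 brick I♭ [FlathCorvallis1979, Thm. 3]), so `σ ≃ ω′` (✔ Bump 3.4.1 ∕ Flath uniqueness,
module form) — an injective intertwiner `σ → ω′`, which is (C♭)'s conclusion.  This is F-ISO's core run at `(σ, ω′)` instead of two carriers.

* `cohFinComponentIsThetaAdm_of_cSharp (hH) (hA) : ‹(C♭)›` — the (C♭) socket from (C♯)hol + conj;
* `hdictE_of_cSharp (hH) (hA) : …Theses.HCCMUnconditional.F0HdictE` — SOCKET 27455 BY ROUTE NAME: ★ `oscillatorTriple_dictionaryExistence_holds_of` at U1′ ★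
  `TowerRealisation.stubU1RealisationAt_holds`, U2′ ★ p798914 fed this (C♭) and (D) ★ p799091, U4 := ★ `F0P2fE3OfRung2.stubU4_of_E3flat (★ e3flat_of_cSharp hH hA)`;
* the crux then reads `HCCMUnconditionalH413OfF0.H413_of_F0HdictE_F0HJ3a (hdictE_of_cSharp hH hA) hJ3a` — modulo {(C♯)hol, conj, 27456} (27457 ★ inside).
⇒ 27455 = ONE constant modulo EXACTLY {(C♯)hol, conj}; when B-p18 (g27)'s conj closer is ★, ED. 2 drops `hA` (one token).

## References
* [Liu2021] Y. Liu, Camb. J. Math. 9 (2021) = arXiv:2102.11518: Prop. 4.13 and proof (Case 1, l. 2121–2147), Rem. 4.14, Def. 4.11–4.12, App. D Lem. D.1.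
* [FlathCorvallis1979] Thm. 3, 4.  [BorelJacquet1979] §4.6.  [Bump1997] §3.4 Prop. 3.4.1.  [GelbartRogawski1991] Thm 5.1.1, Lem 5.1.2.  [Rogawski1992] Thm 1.1.
* [Rogawski1990] Thm 13.3.1, 13.3.6 (c), §15.3.  [Omeara1963] §71.
-/

set_option autoImplicit false

-- the mandated namespace has the single-problem summit's repeated segment (`HodgeConjecture.HodgeConjecture`)
set_option linter.dupNamespace false

noncomputable section

namespace Summit.HodgeConjecture.HodgeConjecture.Cruxes.H413.F0P2mCadmOfCSharp

-- opens: the rung-3 sub-line's (for the (C♯) texts) ∪ ★ `F0P2cSocketC`'s (for the (C♭) text)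
open scoped Matrix ComplexOrder
open NumberField NumberField.InfinitePlace IsDedekindDomain MeasureTheory
open Literature.NumberTheory Literature.NumberTheory.Automorphic Literature.NumberTheory.Automorphic.UnitaryGroup
open Literature.NumberTheory.Automorphic.UnitaryGroup.CotangentForms
open Literature.NumberTheory.Automorphic.Liu2021 Literature.NumberTheory.Automorphic.Liu2021.AppendixC
open Literature.NumberTheory.Automorphic.Liu2021.Def411WeilCarriers
open Literature.NumberTheory.Automorphic.Liu2021.Def411WeilCarriersDoubling
open Literature.NumberTheory.Automorphic.IdeleClassGroup
open Literature.NumberTheory.GelbartRogawski1991 Literature.NumberTheory.GelbartRogawski1991.UnitaryDualPair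
open Literature.NumberTheory.GelbartRogawski1991.UnitaryDualPair.WeilCoinv
open Literature.RepresentationTheory Literature.RepresentationTheory.Liu2021
open Literature.NumberTheory.Rogawski1990
open Literature.NumberTheory.QuadraticForms
open Literature.AlgebraicGeometry.Liu2021 (IsAdmissibleElement)
open Summit.HodgeConjecture.CorCM
open Summit.HodgeConjecture.CorCM.Transposition
open Summit.HodgeConjecture.HodgeConjecture.Cruxes.H413.SpectrumInterfaces (oscillatorTriple_dictionaryExistence_holds_of)

/-! ## §1 (C♭) from (C♯)hol + conj -/

set_option synthInstance.maxHeartbeats 400000 in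
set_option maxHeartbeats 16000000 in
/-- **THE (C♭) SOCKET FROM THE TWO (C♯) STATEMENTS** — hypotheses = `F0P2E3Rung3.StubCSharpHol` and `StubCSharpHol → StubCSharpAntihol` VERBATIM; conclusion =
`F0P2CohFinComponentIsThetaC.CohFinComponentIsThetaAdm` VERBATIM.  (C♯) gives an irreducible admissible theta carrier `ω′` occurring in `P` (★ CI road); ★ P3 brick I♭
makes the smooth part of `P|_{U(H)(𝔸_f)}` isotypic of type `σ` and of type `ω′`, non-zero since `σ ↪` it; ✔ Bump 3.4.1 ∕ Flath Thm. 3 (module form) gives `σ ≃ ω′`.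
[cite: FlathCorvallis1979, Thm. 3] [cite: BorelJacquet1979, §4.6] [cite: Bump1997, §3.4 Prop. 3.4.1] [cite: Liu2021, Prop. 4.13 (Case 1), Def. 4.11, App. D Lem. D.1 (1)] -/
theorem cohFinComponentIsThetaAdm_of_cSharp
    (hH :
      ∀ (L : Type) [Field L] [NumberField L] [IsCMField L] (ι : L →+* ℂ) (H : Matrix (Fin 3) (Fin 3) L) (T : GL (Fin 3) ℂ)
        (hT : (T : Matrix (Fin 3) (Fin 3) ℂ)ᴴ * H.map ι * (T : Matrix (Fin 3) (Fin 3) ℂ) = Literature.Geometry.ComplexHyperbolic.BallModel.J),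
        (∀ τ' : L →+* ℂ, InfinitePlace.mk τ' ≠ InfinitePlace.mk ι → (H.map τ').PosDef) → 2 ≤ Module.finrank ℚ ↥(maximalRealSubfield L) →
        ∀ {n' : ℕ} (e₁ : Fin 3 × Fin 1 ≃ Fin n') (dV : Fin 3 → L) (hdV : ∀ i, IsCMField.complexConj L (dV i) = dV i)
          (hdV0 : ∀ i, dV i ≠ 0) (g : GL (Fin 3) L)
          (hg : ((g : Matrix (Fin 3) (Fin 3) L).map (cmConjRingHom L))ᵀ * H * (g : Matrix (Fin 3) (Fin 3) L) = Matrix.diagonal dV)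
          (ιV : finAdelic (↥(maximalRealSubfield L)) L (IsCMField.complexConj L) 3 H →*
              finAdelic (↥(maximalRealSubfield L)) L (IsCMField.complexConj L) 3 (Matrix.diagonal dV)),
            (∀ k, ((ιV k : finAdelic (↥(maximalRealSubfield L)) L (IsCMField.complexConj L) 3 (Matrix.diagonal dV)) :
                GL (Fin 3) (FiniteAdeleRing (𝓞 L) L)) =
              (toFinAdeleGL L 3 g)⁻¹ * (k : GL (Fin 3) (FiniteAdeleRing (𝓞 L) L)) * toFinAdeleGL L 3 g) →
            ∀ (μA : Measure (adelicGroupData (↥(maximalRealSubfield L)) L (IsCMField.complexConj L) 3 H).automorphicQuotient)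
              [(adelicGroupData (↥(maximalRealSubfield L)) L (IsCMField.complexConj L) 3 H).IsAutomorphicMeasure μA],
              ∀ P : DiscreteAutomorphicRep (adelicGroupData (↥(maximalRealSubfield L)) L (IsCMField.complexConj L) 3 H) μA,
                P.IsHolCotangentAt (cmArchSection L ι H T hT) (cmCompactFactor L ι H T hT) →
                  ∃ (μ : Literature.NumberTheory.Automorphic.IdeleClassGroup L →ₜ* Circle) (hμ : IsConjugateSymplectic L μ),
                    HasWeight L μ 1 ∧
                    ∃ (a : (↥(maximalRealSubfield L))ˣ) (χ : Chi (↥(maximalRealSubfield L)) L (IsCMField.complexConj L)),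
                      IsAdmissibleElement L hμ.cmType.1 (algebraMap (↥(maximalRealSubfield L)) L a * (2 * imagUnit L)⁻¹) ∧
                        P.HasFinComponent
                      (rhoAtLine (↥(maximalRealSubfield L)) L (IsCMField.complexConj L) 3 e₁ (Matrix.diagonal dV)
                        (complexConj_imagUnit L) (imagUnit_ne_zero L) (imagUnit_mul_self L) (realDiagonal_isSymm L dV hdV)
                        (isUnit_det_realDiagonal L dV hdV hdV0) (realDiagonal_map L dV hdV).symm
                        (fun a => isCompatible_chiSplittingLine L e₁ dV hdV hdV0 (toHeckeCharacter L μ)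
                          (isUnitary_toHeckeCharacter L μ) ((isOscillatorChar_toHeckeCharacter_iff μ).mpr hμ)
                          (TW (↥(maximalRealSubfield L)) a) (isSymm_TW (↥(maximalRealSubfield L)) a)
                          (isUnit_det_TW (↥(maximalRealSubfield L)) a) (JW (↥(maximalRealSubfield L)) L a)
                          (JW_eq (↥(maximalRealSubfield L)) L a)) ιV a χ))
    (hA :
     (∀ (L : Type) [Field L] [NumberField L] [IsCMField L] (ι : L →+* ℂ) (H : Matrix (Fin 3) (Fin 3) L) (T : GL (Fin 3) ℂ)
        (hT : (T : Matrix (Fin 3) (Fin 3) ℂ)ᴴ * H.map ι * (T : Matrix (Fin 3) (Fin 3) ℂ) = Literature.Geometry.ComplexHyperbolic.BallModel.J),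
        (∀ τ' : L →+* ℂ, InfinitePlace.mk τ' ≠ InfinitePlace.mk ι → (H.map τ').PosDef) → 2 ≤ Module.finrank ℚ ↥(maximalRealSubfield L) →
        ∀ {n' : ℕ} (e₁ : Fin 3 × Fin 1 ≃ Fin n') (dV : Fin 3 → L) (hdV : ∀ i, IsCMField.complexConj L (dV i) = dV i)
          (hdV0 : ∀ i, dV i ≠ 0) (g : GL (Fin 3) L)
          (hg : ((g : Matrix (Fin 3) (Fin 3) L).map (cmConjRingHom L))ᵀ * H * (g : Matrix (Fin 3) (Fin 3) L) = Matrix.diagonal dV)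
          (ιV : finAdelic (↥(maximalRealSubfield L)) L (IsCMField.complexConj L) 3 H →*
              finAdelic (↥(maximalRealSubfield L)) L (IsCMField.complexConj L) 3 (Matrix.diagonal dV)),
            (∀ k, ((ιV k : finAdelic (↥(maximalRealSubfield L)) L (IsCMField.complexConj L) 3 (Matrix.diagonal dV)) :
                GL (Fin 3) (FiniteAdeleRing (𝓞 L) L)) =
              (toFinAdeleGL L 3 g)⁻¹ * (k : GL (Fin 3) (FiniteAdeleRing (𝓞 L) L)) * toFinAdeleGL L 3 g) →
            ∀ (μA : Measure (adelicGroupData (↥(maximalRealSubfield L)) L (IsCMField.complexConj L) 3 H).automorphicQuotient)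
              [(adelicGroupData (↥(maximalRealSubfield L)) L (IsCMField.complexConj L) 3 H).IsAutomorphicMeasure μA],
              ∀ P : DiscreteAutomorphicRep (adelicGroupData (↥(maximalRealSubfield L)) L (IsCMField.complexConj L) 3 H) μA,
                P.IsHolCotangentAt (cmArchSection L ι H T hT) (cmCompactFactor L ι H T hT) →
                  ∃ (μ : Literature.NumberTheory.Automorphic.IdeleClassGroup L →ₜ* Circle) (hμ : IsConjugateSymplectic L μ),
                    HasWeight L μ 1 ∧
                    ∃ (a : (↥(maximalRealSubfield L))ˣ) (χ : Chi (↥(maximalRealSubfield L)) L (IsCMField.complexConj L)),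
                      IsAdmissibleElement L hμ.cmType.1 (algebraMap (↥(maximalRealSubfield L)) L a * (2 * imagUnit L)⁻¹) ∧
                        P.HasFinComponent
                      (rhoAtLine (↥(maximalRealSubfield L)) L (IsCMField.complexConj L) 3 e₁ (Matrix.diagonal dV)
                        (complexConj_imagUnit L) (imagUnit_ne_zero L) (imagUnit_mul_self L) (realDiagonal_isSymm L dV hdV)
                        (isUnit_det_realDiagonal L dV hdV hdV0) (realDiagonal_map L dV hdV).symm
                        (fun a => isCompatible_chiSplittingLine L e₁ dV hdV hdV0 (toHeckeCharacter L μ)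
                          (isUnitary_toHeckeCharacter L μ) ((isOscillatorChar_toHeckeCharacter_iff μ).mpr hμ)
                          (TW (↥(maximalRealSubfield L)) a) (isSymm_TW (↥(maximalRealSubfield L)) a)
                          (isUnit_det_TW (↥(maximalRealSubfield L)) a) (JW (↥(maximalRealSubfield L)) L a)
                          (JW_eq (↥(maximalRealSubfield L)) L a)) ιV a χ)) →
      ∀ (L : Type) [Field L] [NumberField L] [IsCMField L] (ι : L →+* ℂ) (H : Matrix (Fin 3) (Fin 3) L) (T : GL (Fin 3) ℂ)
        (hT : (T : Matrix (Fin 3) (Fin 3) ℂ)ᴴ * H.map ι * (T : Matrix (Fin 3) (Fin 3) ℂ) = Literature.Geometry.ComplexHyperbolic.BallModel.J),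
        (∀ τ' : L →+* ℂ, InfinitePlace.mk τ' ≠ InfinitePlace.mk ι → (H.map τ').PosDef) → 2 ≤ Module.finrank ℚ ↥(maximalRealSubfield L) →
        ∀ {n' : ℕ} (e₁ : Fin 3 × Fin 1 ≃ Fin n') (dV : Fin 3 → L) (hdV : ∀ i, IsCMField.complexConj L (dV i) = dV i)
          (hdV0 : ∀ i, dV i ≠ 0) (g : GL (Fin 3) L)
          (hg : ((g : Matrix (Fin 3) (Fin 3) L).map (cmConjRingHom L))ᵀ * H * (g : Matrix (Fin 3) (Fin 3) L) = Matrix.diagonal dV)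
          (ιV : finAdelic (↥(maximalRealSubfield L)) L (IsCMField.complexConj L) 3 H →*
              finAdelic (↥(maximalRealSubfield L)) L (IsCMField.complexConj L) 3 (Matrix.diagonal dV)),
            (∀ k, ((ιV k : finAdelic (↥(maximalRealSubfield L)) L (IsCMField.complexConj L) 3 (Matrix.diagonal dV)) :
                GL (Fin 3) (FiniteAdeleRing (𝓞 L) L)) =
              (toFinAdeleGL L 3 g)⁻¹ * (k : GL (Fin 3) (FiniteAdeleRing (𝓞 L) L)) * toFinAdeleGL L 3 g) →
            ∀ (μA : Measure (adelicGroupData (↥(maximalRealSubfield L)) L (IsCMField.complexConj L) 3 H).automorphicQuotient)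
              [(adelicGroupData (↥(maximalRealSubfield L)) L (IsCMField.complexConj L) 3 H).IsAutomorphicMeasure μA],
              ∀ P : DiscreteAutomorphicRep (adelicGroupData (↥(maximalRealSubfield L)) L (IsCMField.complexConj L) 3 H) μA,
                P.IsAntiholCotangentAt (cmArchSection L ι H T hT) (cmCompactFactor L ι H T hT) →
                  ∃ (μ : Literature.NumberTheory.Automorphic.IdeleClassGroup L →ₜ* Circle) (hμ : IsConjugateSymplectic L μ),
                    HasWeight L μ 1 ∧
                    ∃ (a : (↥(maximalRealSubfield L))ˣ) (χ : Chi (↥(maximalRealSubfield L)) L (IsCMField.complexConj L)),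
                      IsAdmissibleElement L hμ.cmType.1 (algebraMap (↥(maximalRealSubfield L)) L a * (2 * imagUnit L)⁻¹) ∧
                        P.HasFinComponent
                      (rhoAtLine (↥(maximalRealSubfield L)) L (IsCMField.complexConj L) 3 e₁ (Matrix.diagonal dV)
                        (complexConj_imagUnit L) (imagUnit_ne_zero L) (imagUnit_mul_self L) (realDiagonal_isSymm L dV hdV)
                        (isUnit_det_realDiagonal L dV hdV hdV0) (realDiagonal_map L dV hdV).symm
                        (fun a => isCompatible_chiSplittingLine L e₁ dV hdV hdV0 (toHeckeCharacter L μ)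
                          (isUnitary_toHeckeCharacter L μ) ((isOscillatorChar_toHeckeCharacter_iff μ).mpr hμ)
                          (TW (↥(maximalRealSubfield L)) a) (isSymm_TW (↥(maximalRealSubfield L)) a)
                          (isUnit_det_TW (↥(maximalRealSubfield L)) a) (JW (↥(maximalRealSubfield L)) L a)
                          (JW_eq (↥(maximalRealSubfield L)) L a)) ιV a χ)) :
    ∀ (L : Type) [Field L] [NumberField L] [IsCMField L] (ι : L →+* ℂ) (H : Matrix (Fin 3) (Fin 3) L) (T : GL (Fin 3) ℂ)
      (hT : (T : Matrix (Fin 3) (Fin 3) ℂ)ᴴ * H.map ι * (T : Matrix (Fin 3) (Fin 3) ℂ) = Literature.Geometry.ComplexHyperbolic.BallModel.J),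
      (∀ τ' : L →+* ℂ, InfinitePlace.mk τ' ≠ InfinitePlace.mk ι → (H.map τ').PosDef) → 2 ≤ Module.finrank ℚ ↥(maximalRealSubfield L) →
      ∀ {n' : ℕ} (e₁ : Fin 3 × Fin 1 ≃ Fin n') (dV : Fin 3 → L) (hdV : ∀ i, IsCMField.complexConj L (dV i) = dV i)
        (hdV0 : ∀ i, dV i ≠ 0) (g : GL (Fin 3) L),
        ((g : Matrix (Fin 3) (Fin 3) L).map (cmConjRingHom L))ᵀ * H * (g : Matrix (Fin 3) (Fin 3) L) = Matrix.diagonal dV →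
        ∀ (ιV : finAdelic (↥(maximalRealSubfield L)) L (IsCMField.complexConj L) 3 H →*
            finAdelic (↥(maximalRealSubfield L)) L (IsCMField.complexConj L) 3 (Matrix.diagonal dV)),
          (∀ k, ((ιV k : finAdelic (↥(maximalRealSubfield L)) L (IsCMField.complexConj L) 3 (Matrix.diagonal dV)) :
              GL (Fin 3) (FiniteAdeleRing (𝓞 L) L)) =
            (toFinAdeleGL L 3 g)⁻¹ * (k : GL (Fin 3) (FiniteAdeleRing (𝓞 L) L)) * toFinAdeleGL L 3 g) →
          ∀ (μ : Measure (adelicGroupData (↥(maximalRealSubfield L)) L (IsCMField.complexConj L) 3 H).automorphicQuotient)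
            [(adelicGroupData (↥(maximalRealSubfield L)) L (IsCMField.complexConj L) 3 H).IsAutomorphicMeasure μ]
            (W : Type) [AddCommGroup W] [Module ℂ W]
            (σ : Representation ℂ (finAdelic (↥(maximalRealSubfield L)) L (IsCMField.complexConj L) 3 H) W),
            σ.IsIrreducible → σ.IsSmooth → σ.IsAdmissible →
            ∀ P : DiscreteAutomorphicRep (adelicGroupData (↥(maximalRealSubfield L)) L (IsCMField.complexConj L) 3 H) μ,
              (P.IsHolCotangentAt (cmArchSection L ι H T hT) (cmCompactFactor L ι H T hT) ∨
                P.IsAntiholCotangentAt (cmArchSection L ι H T hT) (cmCompactFactor L ι H T hT)) →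
              P.HasFinComponent σ →
              ∃ (μ : Literature.NumberTheory.Automorphic.IdeleClassGroup L →ₜ* Circle) (hμ : IsConjugateSymplectic L μ), HasWeight L μ 1 ∧
                ∃ (a : (↥(maximalRealSubfield L))ˣ) (χ : Chi (↥(maximalRealSubfield L)) L (IsCMField.complexConj L)),
                  ∃ f : σ.IntertwiningMap
                    (rhoAtLine (↥(maximalRealSubfield L)) L (IsCMField.complexConj L) 3 e₁ (Matrix.diagonal dV)
                    (complexConj_imagUnit L) (imagUnit_ne_zero L) (imagUnit_mul_self L) (realDiagonal_isSymm L dV hdV)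
                    (isUnit_det_realDiagonal L dV hdV hdV0) (realDiagonal_map L dV hdV).symm
                    (fun a => isCompatible_chiSplittingLine L e₁ dV hdV hdV0 (toHeckeCharacter L μ)
                      (isUnitary_toHeckeCharacter L μ) ((isOscillatorChar_toHeckeCharacter_iff μ).mpr hμ)
                      (TW (↥(maximalRealSubfield L)) a) (isSymm_TW (↥(maximalRealSubfield L)) a)
                      (isUnit_det_TW (↥(maximalRealSubfield L)) a) (JW (↥(maximalRealSubfield L)) L a)
                      (JW_eq (↥(maximalRealSubfield L)) L a)) ιV a χ),
                    Function.Injective f := by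
  intro L _ _ _ ι H T hT hpos h2 n' e₁ dV hdV hdV0 g hg ιV hιV μA _ W _ _ σ hirr hsm hadm P hP hfin
  -- (C♯): an admissible realisation of `P_f` by a theta carrier (case split on the Hodge type)
  obtain ⟨μ', hμ', hw', a', χ', -, hfc'⟩ :
      ∃ (μ' : Literature.NumberTheory.Automorphic.IdeleClassGroup L →ₜ* Circle) (hμ' : IsConjugateSymplectic L μ'),
        HasWeight L μ' 1 ∧ ∃ (a' : (↥(maximalRealSubfield L))ˣ) (χ' : Chi (↥(maximalRealSubfield L)) L (IsCMField.complexConj L)),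
          IsAdmissibleElement L hμ'.cmType.1 (algebraMap (↥(maximalRealSubfield L)) L a' * (2 * imagUnit L)⁻¹) ∧
          P.HasFinComponent
            (rhoAtLine (↥(maximalRealSubfield L)) L (IsCMField.complexConj L) 3 e₁ (Matrix.diagonal dV)
              (complexConj_imagUnit L) (imagUnit_ne_zero L) (imagUnit_mul_self L) (realDiagonal_isSymm L dV hdV)
              (isUnit_det_realDiagonal L dV hdV hdV0) (realDiagonal_map L dV hdV).symm
              (fun a => isCompatible_chiSplittingLine L e₁ dV hdV hdV0 (toHeckeCharacter L μ')
                (isUnitary_toHeckeCharacter L μ') ((isOscillatorChar_toHeckeCharacter_iff μ').mpr hμ')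
                (TW (↥(maximalRealSubfield L)) a) (isSymm_TW (↥(maximalRealSubfield L)) a)
                (isUnit_det_TW (↥(maximalRealSubfield L)) a) (JW (↥(maximalRealSubfield L)) L a)
                (JW_eq (↥(maximalRealSubfield L)) L a)) ιV a' χ') := by
    rcases hP with hP | hP
    · exact hH L ι H T hT hpos h2 e₁ dV hdV hdV0 g hg ιV hιV μA P hP
    · exact hA hH L ι H T hT hpos h2 e₁ dV hdV hdV0 g hg ιV hιV μA P hP
  -- the realising carrier `ω′` is irreducible and admissible (★ CI road)
  have hirr' := F0P2cStubCI.rhoAtLine_chi_isIrreducible L H e₁ dV hdV hdV0 g hg ιV hιV μ' hμ' a' χ'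
  have hadm' := F0P2cStubCI.rhoAtLine_chi_isAdmissible L H e₁ dV hdV hdV0 g hg ιV hιV μ' hμ' a' χ'
  -- the smooth part of `P|_{U(H)(𝔸_f)}` is `σ`-isotypic (`= ⊤`) and isotypic of type `ω′` (★ P3 brick I♭)
  have hS := F0P3FinPartIsotypic.isotypicComponent_finRep_smoothPart_eq_top P σ hirr hadm hfin
  have hS' := F0P3FinPartIsotypic.isIsotypicOfType_finRep_smoothPart P _ hirr' hadm' hfc'
  -- it is non-zero: `σ ≠ 0` embeds into it
  obtain ⟨f₁, hf₁⟩ := F0P3FinRepConstituentsExist.exists_intertwiningMap_smoothPart_of_hasFinComponent P hsm hfin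
  haveI hW := @Literature.RepresentationTheory.Semisimple.Representation.nontrivial_of_isIrreducible _ _ _ _ _ _ _ _ hirr
  haveI : Nontrivial ((Representation.smoothPart P.finRep).toRepresentation).asModule := hf₁.nontrivial
  haveI := (Representation.irreducible_iff_isSimpleModule_asModule _).mp hirr
  -- type uniqueness: `σ.asModule ≃ ω′.asModule` over `ℂ[U(H)(𝔸_f)]`, hence `σ ≃ ω′`
  obtain ⟨e'⟩ := nonempty_linearEquiv_of_isotypicComponent_eq_top_of_isIsotypicOfType hS hS'
  let E := ((Representation.IntertwiningMap.equivLinearMapAsModule _ _).symm e'.toLinearMap).ofBijective e'.bijective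
  exact ⟨μ', hμ', hw', a', χ', E.toIntertwiningMap, E.toLinearEquiv.injective⟩

/-! ## §2 Socket 27455 `F0HdictE` and the crux from (C♯)hol + conj -/

set_option synthInstance.maxHeartbeats 400000 in
set_option maxHeartbeats 16000000 in
/-- **SOCKET 27455 `HCCMUnconditional.F0HdictE` BY ROUTE NAME FROM (C♯)hol + conj** — U1′ ★ `TowerRealisation.stubU1RealisationAt_holds`, U2′ ★ p798914 fed the (C♭) socket
of §1 and the (D) socket ★ p799091, U4 ★ `F0P2fE3OfRung2.stubU4_of_E3flat` fed E3♭ ★ `F0P2mE3FlatInfOfRung3.e3flat_of_cSharp hH hA`; ★ `oscillatorTriple_dictionaryExistence_holds_of`;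
the route ∕ socket `def`s unfold by `delta`.  No PK ∕ PKΠ ∕ S2♯ ∕ GR91N ∕ D7α on this road. [cite: Liu2021, Prop. 4.13 and proof l. 2121–2147, Rem. 4.14]
[cite: GelbartRogawski1991, Thm 5.1.1] [cite: Rogawski1992, Thm 1.1] [cite: FlathCorvallis1979, Thm. 3] -/
theorem hdictE_of_cSharp
    (hH :
      ∀ (L : Type) [Field L] [NumberField L] [IsCMField L] (ι : L →+* ℂ) (H : Matrix (Fin 3) (Fin 3) L) (T : GL (Fin 3) ℂ)
        (hT : (T : Matrix (Fin 3) (Fin 3) ℂ)ᴴ * H.map ι * (T : Matrix (Fin 3) (Fin 3) ℂ) = Literature.Geometry.ComplexHyperbolic.BallModel.J),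
        (∀ τ' : L →+* ℂ, InfinitePlace.mk τ' ≠ InfinitePlace.mk ι → (H.map τ').PosDef) → 2 ≤ Module.finrank ℚ ↥(maximalRealSubfield L) →
        ∀ {n' : ℕ} (e₁ : Fin 3 × Fin 1 ≃ Fin n') (dV : Fin 3 → L) (hdV : ∀ i, IsCMField.complexConj L (dV i) = dV i)
          (hdV0 : ∀ i, dV i ≠ 0) (g : GL (Fin 3) L)
          (hg : ((g : Matrix (Fin 3) (Fin 3) L).map (cmConjRingHom L))ᵀ * H * (g : Matrix (Fin 3) (Fin 3) L) = Matrix.diagonal dV)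
          (ιV : finAdelic (↥(maximalRealSubfield L)) L (IsCMField.complexConj L) 3 H →*
              finAdelic (↥(maximalRealSubfield L)) L (IsCMField.complexConj L) 3 (Matrix.diagonal dV)),
            (∀ k, ((ιV k : finAdelic (↥(maximalRealSubfield L)) L (IsCMField.complexConj L) 3 (Matrix.diagonal dV)) :
                GL (Fin 3) (FiniteAdeleRing (𝓞 L) L)) =
              (toFinAdeleGL L 3 g)⁻¹ * (k : GL (Fin 3) (FiniteAdeleRing (𝓞 L) L)) * toFinAdeleGL L 3 g) →
            ∀ (μA : Measure (adelicGroupData (↥(maximalRealSubfield L)) L (IsCMField.complexConj L) 3 H).automorphicQuotient)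
              [(adelicGroupData (↥(maximalRealSubfield L)) L (IsCMField.complexConj L) 3 H).IsAutomorphicMeasure μA],
              ∀ P : DiscreteAutomorphicRep (adelicGroupData (↥(maximalRealSubfield L)) L (IsCMField.complexConj L) 3 H) μA,
                P.IsHolCotangentAt (cmArchSection L ι H T hT) (cmCompactFactor L ι H T hT) →
                  ∃ (μ : Literature.NumberTheory.Automorphic.IdeleClassGroup L →ₜ* Circle) (hμ : IsConjugateSymplectic L μ),
                    HasWeight L μ 1 ∧
                    ∃ (a : (↥(maximalRealSubfield L))ˣ) (χ : Chi (↥(maximalRealSubfield L)) L (IsCMField.complexConj L)),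
                      IsAdmissibleElement L hμ.cmType.1 (algebraMap (↥(maximalRealSubfield L)) L a * (2 * imagUnit L)⁻¹) ∧
                        P.HasFinComponent
                      (rhoAtLine (↥(maximalRealSubfield L)) L (IsCMField.complexConj L) 3 e₁ (Matrix.diagonal dV)
                        (complexConj_imagUnit L) (imagUnit_ne_zero L) (imagUnit_mul_self L) (realDiagonal_isSymm L dV hdV)
                        (isUnit_det_realDiagonal L dV hdV hdV0) (realDiagonal_map L dV hdV).symm
                        (fun a => isCompatible_chiSplittingLine L e₁ dV hdV hdV0 (toHeckeCharacter L μ)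
                          (isUnitary_toHeckeCharacter L μ) ((isOscillatorChar_toHeckeCharacter_iff μ).mpr hμ)
                          (TW (↥(maximalRealSubfield L)) a) (isSymm_TW (↥(maximalRealSubfield L)) a)
                          (isUnit_det_TW (↥(maximalRealSubfield L)) a) (JW (↥(maximalRealSubfield L)) L a)
                          (JW_eq (↥(maximalRealSubfield L)) L a)) ιV a χ))
    (hA :
     (∀ (L : Type) [Field L] [NumberField L] [IsCMField L] (ι : L →+* ℂ) (H : Matrix (Fin 3) (Fin 3) L) (T : GL (Fin 3) ℂ)
        (hT : (T : Matrix (Fin 3) (Fin 3) ℂ)ᴴ * H.map ι * (T : Matrix (Fin 3) (Fin 3) ℂ) = Literature.Geometry.ComplexHyperbolic.BallModel.J),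
        (∀ τ' : L →+* ℂ, InfinitePlace.mk τ' ≠ InfinitePlace.mk ι → (H.map τ').PosDef) → 2 ≤ Module.finrank ℚ ↥(maximalRealSubfield L) →
        ∀ {n' : ℕ} (e₁ : Fin 3 × Fin 1 ≃ Fin n') (dV : Fin 3 → L) (hdV : ∀ i, IsCMField.complexConj L (dV i) = dV i)
          (hdV0 : ∀ i, dV i ≠ 0) (g : GL (Fin 3) L)
          (hg : ((g : Matrix (Fin 3) (Fin 3) L).map (cmConjRingHom L))ᵀ * H * (g : Matrix (Fin 3) (Fin 3) L) = Matrix.diagonal dV)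
          (ιV : finAdelic (↥(maximalRealSubfield L)) L (IsCMField.complexConj L) 3 H →*
              finAdelic (↥(maximalRealSubfield L)) L (IsCMField.complexConj L) 3 (Matrix.diagonal dV)),
            (∀ k, ((ιV k : finAdelic (↥(maximalRealSubfield L)) L (IsCMField.complexConj L) 3 (Matrix.diagonal dV)) :
                GL (Fin 3) (FiniteAdeleRing (𝓞 L) L)) =
              (toFinAdeleGL L 3 g)⁻¹ * (k : GL (Fin 3) (FiniteAdeleRing (𝓞 L) L)) * toFinAdeleGL L 3 g) →
            ∀ (μA : Measure (adelicGroupData (↥(maximalRealSubfield L)) L (IsCMField.complexConj L) 3 H).automorphicQuotient)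
              [(adelicGroupData (↥(maximalRealSubfield L)) L (IsCMField.complexConj L) 3 H).IsAutomorphicMeasure μA],
              ∀ P : DiscreteAutomorphicRep (adelicGroupData (↥(maximalRealSubfield L)) L (IsCMField.complexConj L) 3 H) μA,
                P.IsHolCotangentAt (cmArchSection L ι H T hT) (cmCompactFactor L ι H T hT) →
                  ∃ (μ : Literature.NumberTheory.Automorphic.IdeleClassGroup L →ₜ* Circle) (hμ : IsConjugateSymplectic L μ),
                    HasWeight L μ 1 ∧
                    ∃ (a : (↥(maximalRealSubfield L))ˣ) (χ : Chi (↥(maximalRealSubfield L)) L (IsCMField.complexConj L)),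
                      IsAdmissibleElement L hμ.cmType.1 (algebraMap (↥(maximalRealSubfield L)) L a * (2 * imagUnit L)⁻¹) ∧
                        P.HasFinComponent
                      (rhoAtLine (↥(maximalRealSubfield L)) L (IsCMField.complexConj L) 3 e₁ (Matrix.diagonal dV)
                        (complexConj_imagUnit L) (imagUnit_ne_zero L) (imagUnit_mul_self L) (realDiagonal_isSymm L dV hdV)
                        (isUnit_det_realDiagonal L dV hdV hdV0) (realDiagonal_map L dV hdV).symm
                        (fun a => isCompatible_chiSplittingLine L e₁ dV hdV hdV0 (toHeckeCharacter L μ)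
                          (isUnitary_toHeckeCharacter L μ) ((isOscillatorChar_toHeckeCharacter_iff μ).mpr hμ)
                          (TW (↥(maximalRealSubfield L)) a) (isSymm_TW (↥(maximalRealSubfield L)) a)
                          (isUnit_det_TW (↥(maximalRealSubfield L)) a) (JW (↥(maximalRealSubfield L)) L a)
                          (JW_eq (↥(maximalRealSubfield L)) L a)) ιV a χ)) →
      ∀ (L : Type) [Field L] [NumberField L] [IsCMField L] (ι : L →+* ℂ) (H : Matrix (Fin 3) (Fin 3) L) (T : GL (Fin 3) ℂ)
        (hT : (T : Matrix (Fin 3) (Fin 3) ℂ)ᴴ * H.map ι * (T : Matrix (Fin 3) (Fin 3) ℂ) = Literature.Geometry.ComplexHyperbolic.BallModel.J),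
        (∀ τ' : L →+* ℂ, InfinitePlace.mk τ' ≠ InfinitePlace.mk ι → (H.map τ').PosDef) → 2 ≤ Module.finrank ℚ ↥(maximalRealSubfield L) →
        ∀ {n' : ℕ} (e₁ : Fin 3 × Fin 1 ≃ Fin n') (dV : Fin 3 → L) (hdV : ∀ i, IsCMField.complexConj L (dV i) = dV i)
          (hdV0 : ∀ i, dV i ≠ 0) (g : GL (Fin 3) L)
          (hg : ((g : Matrix (Fin 3) (Fin 3) L).map (cmConjRingHom L))ᵀ * H * (g : Matrix (Fin 3) (Fin 3) L) = Matrix.diagonal dV)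
          (ιV : finAdelic (↥(maximalRealSubfield L)) L (IsCMField.complexConj L) 3 H →*
              finAdelic (↥(maximalRealSubfield L)) L (IsCMField.complexConj L) 3 (Matrix.diagonal dV)),
            (∀ k, ((ιV k : finAdelic (↥(maximalRealSubfield L)) L (IsCMField.complexConj L) 3 (Matrix.diagonal dV)) :
                GL (Fin 3) (FiniteAdeleRing (𝓞 L) L)) =
              (toFinAdeleGL L 3 g)⁻¹ * (k : GL (Fin 3) (FiniteAdeleRing (𝓞 L) L)) * toFinAdeleGL L 3 g) →
            ∀ (μA : Measure (adelicGroupData (↥(maximalRealSubfield L)) L (IsCMField.complexConj L) 3 H).automorphicQuotient)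
              [(adelicGroupData (↥(maximalRealSubfield L)) L (IsCMField.complexConj L) 3 H).IsAutomorphicMeasure μA],
              ∀ P : DiscreteAutomorphicRep (adelicGroupData (↥(maximalRealSubfield L)) L (IsCMField.complexConj L) 3 H) μA,
                P.IsAntiholCotangentAt (cmArchSection L ι H T hT) (cmCompactFactor L ι H T hT) →
                  ∃ (μ : Literature.NumberTheory.Automorphic.IdeleClassGroup L →ₜ* Circle) (hμ : IsConjugateSymplectic L μ),
                    HasWeight L μ 1 ∧
                    ∃ (a : (↥(maximalRealSubfield L))ˣ) (χ : Chi (↥(maximalRealSubfield L)) L (IsCMField.complexConj L)),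
                      IsAdmissibleElement L hμ.cmType.1 (algebraMap (↥(maximalRealSubfield L)) L a * (2 * imagUnit L)⁻¹) ∧
                        P.HasFinComponent
                      (rhoAtLine (↥(maximalRealSubfield L)) L (IsCMField.complexConj L) 3 e₁ (Matrix.diagonal dV)
                        (complexConj_imagUnit L) (imagUnit_ne_zero L) (imagUnit_mul_self L) (realDiagonal_isSymm L dV hdV)
                        (isUnit_det_realDiagonal L dV hdV hdV0) (realDiagonal_map L dV hdV).symm
                        (fun a => isCompatible_chiSplittingLine L e₁ dV hdV hdV0 (toHeckeCharacter L μ)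
                          (isUnitary_toHeckeCharacter L μ) ((isOscillatorChar_toHeckeCharacter_iff μ).mpr hμ)
                          (TW (↥(maximalRealSubfield L)) a) (isSymm_TW (↥(maximalRealSubfield L)) a)
                          (isUnit_det_TW (↥(maximalRealSubfield L)) a) (JW (↥(maximalRealSubfield L)) L a)
                          (JW_eq (↥(maximalRealSubfield L)) L a)) ιV a χ)) :
    Summit.HodgeConjecture.HodgeConjecture.Theses.HCCMUnconditional.F0HdictE := by
  delta Summit.HodgeConjecture.HodgeConjecture.Theses.HCCMUnconditional.F0HdictE
    Summit.HodgeConjecture.HodgeConjecture.Theorems.F0FloorSockets.HdictEType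
  exact
    oscillatorTriple_dictionaryExistence_holds_of TowerRealisation.stubU1RealisationAt_holds
      (P2StubU2OfLettersCadmD.stub_U2_cohFormsSpectrumIsThetaAt_of_Cadm_D (cohFinComponentIsThetaAdm_of_cSharp hH hA)
        F0P2dSocketD.holCotFormSpectralProjection_holds)
      (F0P2fE3OfRung2.stubU4_of_E3flat (F0P2mE3FlatInfOfRung3.e3flat_of_cSharp hH hA))

end Summit.HodgeConjecture.HodgeConjecture.Cruxes.H413.F0P2mCadmOfCSharp

end
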